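import Summits.ValiantsHypothesis.ValiantsHypothesis.Theorems.DefinabilityGapUnitRigidityForms
import HarnessLib

/-!
# DefinabilityGap — UNIT RIGIDITY, stage S1b: elementary words (`wmat_zero_one_eq_zero`)

Second file of the series S1a / S1b / S2 (decomp-valiant bus, OFFER O-L5-UR, CALL l.1120 «ELEMENTARY WORDS»).
A LETTER is `T(a, κ, μ) = E(a) · diag(κ, μ)` with `a` in the `c`-local span `locSpan K σ c` (S1a) and scalars
`κ, μ ∈ Kˣ`; `wmat w` is the product of a word of letters. MAIN THEOREM `wmat_zero_one_eq_zero`: for `c < m`,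
over any field `K`, for every word `w` (any length): `per_m ∣ (wmat w)₀₁ ⇒ (wmat w)₀₁ = 0`.

Proof (Cohn 1966 `GE₂` standard form + Allender–Wang row walk, all entries kept `c`-local):
(a) STANDARD FORM `exists_std`: `wmat w = diag(α, β) · E(b) · eprod rest` with `b ∈ locSpan`, `rest ⊆ locSpan` and
    every INTERIOR letter (`rest.tail`) non-constant — by induction on the word, pushing one letter at a time
    (`std_mul_eM`: relations (M1) `E(y)E(0)E(a) = -E(y+a)`, (M2) `E(x)E(γ)E(a) = diag·E·E` for a unit constant `γ`,
    `std_mul_dmat` / `eprod_mul_dmat`: (M3) diagonal letters migrate to the front, rescaling letters by constants).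
    THE TWO ENDS: the first letter `b` and the last letter `rest.head` are unconstrained (constants allowed) —
    `b` enters the walk as its start state, `rest.head` never enters `(wmat w)₀₁ = α · (E(b) · eprod rest.tail)₀₀`.
(b) ROW WALK `walk` along `eprod rest.tail` from `E(b)`: the state `(x, y)` = row `0` moves by
    `(x, y) ↦ (x z - y, x)`
    and stays in `J := (x ≠ 0 ∧ per_m ∤ topForm x ∧ deg y ≤ deg x)` or `Z := (x = 0 ∧ y = 1)` (`walk_step` of S1a:
    non-constant `c`-local steps have top forms prime to `per_m`, `locSpan ∩ (per_m) = 0`).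
(c) END: `(wmat w)₀₁ = C α · x` with `x` the final walk abscissa: `Z` gives `0`, `J` gives `per_m ∤ C α · x`.
Kernel sub-case of the leaf `hZ` of `DefinabilityGapZperTransfer.chainVal_eq_zero_of_bind₁_kiPer` is completed in
S2 (unit links are letter words). Closes no item; 0 S-currency; rung 0; VP ≠ VNP untouched.
-/

open MvPolynomial Finset
open Literature.Computability.AlgebraicComplexity
open Summit.ValiantsHypothesis.ValiantsHypothesis.Theorems.DefinabilityGapUnitRigidityForms

namespace Summit.ValiantsHypothesis.ValiantsHypothesis.Theorems.DefinabilityGapUnitRigidityWords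

noncomputable section

variable {K : Type*} [Field K]

/-! ## 1. Words -/

section Generic

variable {A : Type*} [CommRing A] [Algebra K A]

/-- REVERSED product of elementary letters: `eprod [z₁, …, z_s] = E(z_s) ⋯ E(z₁)`. [this file] -/
def eprod : List A → Matrix (Fin 2) (Fin 2) A
  | [] => 1
  | z :: t => eprod t * eM z

/-- [this file] -/
@[simp] theorem eprod_nil : eprod ([] : List A) = 1 := rfl

/-- [this file] -/
@[simp] theorem eprod_cons (z : A) (t : List A) : eprod (z :: t) = eprod t * eM z := rfl

variable (K) in
/-- The matrix of a WORD of letters `(a, κ, μ) ↦ T(a, κ, μ) = E(a) · diag(κ, μ)` (`κ, μ` scalars of `K`).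
[this file] -/
def wmat (w : List (A × K × K)) : Matrix (Fin 2) (Fin 2) A :=
  (w.map fun t => eM t.1 * dmat (algebraMap K A t.2.1) (algebraMap K A t.2.2)).prod

/-- [this file] -/
theorem wmat_nil : wmat K ([] : List (A × K × K)) = 1 := by
  simp [wmat]

/-- [this file] -/
theorem wmat_cons (t : A × K × K) (w : List (A × K × K)) :
    wmat K (t :: w) = eM t.1 * dmat (algebraMap K A t.2.1) (algebraMap K A t.2.2) * wmat K w := by
  simp [wmat]

/-- [this file] -/
theorem wmat_append (w w' : List (A × K × K)) : wmat K (w ++ w') = wmat K w * wmat K w' := by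
  simp [wmat]

end Generic

/-! ## 2. Standard forms over `K[σ]` -/

section Std

variable {σ : Type*} {c : ℕ}

/-- (M3) along a reversed product: a diagonal letter migrates to the front of `eprod t`, rescaling the letters by
non-zero constants (same `c`-locality, same degrees). [this file] -/
theorem eprod_mul_dmat (t : List (MvPolynomial σ K)) (ht : ∀ z ∈ t, z ∈ locSpan K σ c) {κ μ : K}
    (hκ : κ ≠ 0) (hμ : μ ≠ 0) :
    ∃ (κ' μ' : K) (t' : List (MvPolynomial σ K)), κ' ≠ 0 ∧ μ' ≠ 0 ∧ (∀ z ∈ t', z ∈ locSpan K σ c) ∧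
      t'.map totalDegree = t.map totalDegree ∧
      eprod t * dmat (C κ) (C μ) = dmat (C κ') (C μ') * eprod t' := by
  induction t generalizing κ μ with
  | nil => exact ⟨κ, μ, [], hκ, hμ, by simp, rfl, by simp⟩
  | cons z t ih =>
    obtain ⟨κ', μ', t', hκ', hμ', ht', hdeg, he⟩ := ih (fun y hy => ht y (List.mem_cons_of_mem _ hy)) hμ hκ
    have hinv : C μ * C μ⁻¹ = (1 : MvPolynomial σ K) := by rw [← C_mul, mul_inv_cancel₀ hμ, C_1]
    refine ⟨κ', μ', (C (μ⁻¹ * κ) * z) :: t', hκ', hμ', ?_, ?_, ?_⟩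
    · intro y hy
      rcases List.mem_cons.1 hy with rfl | hy
      · exact C_mul_mem_locSpan (ht z (by simp)) _
      · exact ht' y hy
    · rw [List.map_cons, List.map_cons, hdeg, totalDegree_C_mul (mul_ne_zero (inv_ne_zero hμ) hκ)]
    · simp only [eprod_cons, Matrix.mul_assoc, map_mul]
      rw [eM_mul_dmat z (C κ) (C μ) (C μ⁻¹) hinv, conj₂ he]

/-- Appending a DIAGONAL letter to a standard form `diag(α, β) · E(b) · eprod rest`. [this file] -/
theorem std_mul_dmat {M : Matrix (Fin 2) (Fin 2) (MvPolynomial σ K)} {α β : K} {b : MvPolynomial σ K}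
    {rest : List (MvPolynomial σ K)} (hα : α ≠ 0) (hβ : β ≠ 0) (hb : b ∈ locSpan K σ c)
    (hrest : ∀ z ∈ rest, z ∈ locSpan K σ c) (htail : ∀ z ∈ rest.tail, z.totalDegree ≠ 0)
    (hM : M = dmat (C α) (C β) * eM b * eprod rest) {κ μ : K} (hκ : κ ≠ 0) (hμ : μ ≠ 0) :
    ∃ (α' β' : K) (b' : MvPolynomial σ K) (rest' : List (MvPolynomial σ K)), α' ≠ 0 ∧ β' ≠ 0 ∧
      b' ∈ locSpan K σ c ∧ (∀ z ∈ rest', z ∈ locSpan K σ c) ∧ (∀ z ∈ rest'.tail, z.totalDegree ≠ 0) ∧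
      M * dmat (C κ) (C μ) = dmat (C α') (C β') * eM b' * eprod rest' := by
  subst hM
  obtain ⟨κ', μ', rest', hκ', hμ', hrest', hdeg, he⟩ := eprod_mul_dmat rest hrest hκ hμ
  have hinv : C μ' * C μ'⁻¹ = (1 : MvPolynomial σ K) := by rw [← C_mul, mul_inv_cancel₀ hμ', C_1]
  refine ⟨α * μ', β * κ', C (μ'⁻¹ * κ') * b, rest', mul_ne_zero hα hμ', mul_ne_zero hβ hκ',
    C_mul_mem_locSpan hb _, hrest', ?_, ?_⟩
  · intro y hy
    have hmem : y.totalDegree ∈ rest.tail.map totalDegree := by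
      rw [List.map_tail, ← hdeg, ← List.map_tail]
      exact List.mem_map.2 ⟨y, hy, rfl⟩
    obtain ⟨y₀, hy₀, hdy⟩ := List.mem_map.1 hmem
    rw [← hdy]
    exact htail y₀ hy₀
  · simp only [Matrix.mul_assoc, map_mul]
    rw [he, conj₂ (eM_mul_dmat b (C κ') (C μ') (C μ'⁻¹) hinv), dmat_mul_dmat_mul]

/-- Appending an ELEMENTARY letter `E(a)`, `a ∈ locSpan`, to a standard form (Cohn's relations (M1)–(M3)); the
first letter `b` and the last letter stay unconstrained, interior letters stay non-constant. [this file] -/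
theorem std_mul_eM {M : Matrix (Fin 2) (Fin 2) (MvPolynomial σ K)} {α β : K} {b : MvPolynomial σ K}
    {rest : List (MvPolynomial σ K)} (hα : α ≠ 0) (hβ : β ≠ 0) (hb : b ∈ locSpan K σ c)
    (hrest : ∀ z ∈ rest, z ∈ locSpan K σ c) (htail : ∀ z ∈ rest.tail, z.totalDegree ≠ 0)
    (hM : M = dmat (C α) (C β) * eM b * eprod rest) {a : MvPolynomial σ K} (ha : a ∈ locSpan K σ c) :
    ∃ (α' β' : K) (b' : MvPolynomial σ K) (rest' : List (MvPolynomial σ K)), α' ≠ 0 ∧ β' ≠ 0 ∧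
      b' ∈ locSpan K σ c ∧ (∀ z ∈ rest', z ∈ locSpan K σ c) ∧ (∀ z ∈ rest'.tail, z.totalDegree ≠ 0) ∧
      M * eM a = dmat (C α') (C β') * eM b' * eprod rest' := by
  subst hM
  rcases rest with _ | ⟨z, t⟩
  · -- (A) `rest = []`: `a` becomes the (free) last letter.
    exact ⟨α, β, b, [a], hα, hβ, hb, by simpa using ha, by simp, by simp [Matrix.mul_assoc]⟩
  by_cases hz : z.totalDegree = 0
  swap
  · -- (B) the old last letter `z` is non-constant: it becomes interior, `a` the last letter.
    refine ⟨α, β, b, a :: z :: t, hα, hβ, hb, ?_, ?_, by simp only [eprod_cons, Matrix.mul_assoc]⟩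
    · intro y hy
      rcases List.mem_cons.1 hy with rfl | hy
      exacts [ha, hrest y hy]
    · intro y hy
      rcases List.mem_cons.1 hy with rfl | hy
      exacts [hz, htail y hy]
  -- (C) the old last letter is a constant `C γ`.
  have hzC : z = C (z.coeff 0) := totalDegree_eq_zero_iff_eq_C.1 hz
  by_cases hγ : z.coeff 0 = 0
  · -- (C1) `γ = 0`: relation (M1), the sign `diag(-1,-1)` migrates to the front.
    have hz0 : z = 0 := by rw [hzC, hγ, C_0]
    subst hz0
    rcases t with _ | ⟨y, t'⟩
    · refine ⟨-α, -β, b + a, [], neg_ne_zero.2 hα, neg_ne_zero.2 hβ, Submodule.add_mem _ hb ha,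
        by simp, by simp, ?_⟩
      simp only [eprod_cons, eprod_nil, Matrix.mul_assoc, Matrix.one_mul, Matrix.mul_one, map_neg]
      rw [eM_mul_eM_zero_mul_eM, dmat_mul_dmat_mul, mul_neg_one, mul_neg_one]
    · refine ⟨-α, -β, b, (y + a) :: t', neg_ne_zero.2 hα, neg_ne_zero.2 hβ, hb, ?_, ?_, ?_⟩
      · intro x hx
        rcases List.mem_cons.1 hx with rfl | hx
        · exact Submodule.add_mem _ (hrest y (by simp)) ha
        · exact hrest x (by simp [hx])
      · intro x hx
        exact htail x (List.mem_cons_of_mem _ hx)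
      · simp only [eprod_cons, Matrix.mul_assoc, map_neg]
        rw [eM_mul_eM_zero_mul_eM, mul_dmat_neg_one_mul (eprod t'), mul_dmat_neg_one_mul (eM b),
          dmat_mul_dmat_mul, mul_neg_one, mul_neg_one]
  · -- (C2) `γ ≠ 0`: relation (M2), then the diagonal migrates to the front by (M3).
    obtain ⟨γ, hγ0, rfl⟩ : ∃ γ : K, γ ≠ 0 ∧ z = C γ := ⟨z.coeff 0, hγ, hzC⟩
    have hinv : C γ * C γ⁻¹ = (1 : MvPolynomial σ K) := by rw [← C_mul, mul_inv_cancel₀ hγ0, C_1]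
    have hpow : ∀ x : MvPolynomial σ K, x ∈ locSpan K σ c → C γ ^ 2 * x - C γ ∈ locSpan K σ c := fun x hx =>
      Submodule.sub_mem _ (by rw [← map_pow]; exact C_mul_mem_locSpan hx _) (C_mem_locSpan c γ)
    rcases t with _ | ⟨x, t'⟩
    · refine ⟨α * γ⁻¹, β * γ, C γ ^ 2 * b - C γ, [a - C γ⁻¹], mul_ne_zero hα (inv_ne_zero hγ0),
        mul_ne_zero hβ hγ0, hpow b hb, by simpa using Submodule.sub_mem _ ha (C_mem_locSpan c γ⁻¹),
        by simp, ?_⟩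
      simp only [eprod_cons, eprod_nil, Matrix.mul_assoc, Matrix.one_mul, map_mul]
      rw [eM_mul_eM_unit_mul_eM b a (C γ) (C γ⁻¹) hinv, dmat_mul_dmat_mul]
    · have hx0 : x.totalDegree ≠ 0 := htail x (by simp)
      obtain ⟨κ', μ', t₃, hκ', hμ', ht₃, hdeg₃, he⟩ :=
        eprod_mul_dmat t' (fun y hy => hrest y (by simp [hy])) (inv_ne_zero hγ0) hγ0
      have hinv' : C μ' * C μ'⁻¹ = (1 : MvPolynomial σ K) := by rw [← C_mul, mul_inv_cancel₀ hμ', C_1]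
      refine ⟨α * μ', β * κ', C (μ'⁻¹ * κ') * b, (a - C γ⁻¹) :: (C γ ^ 2 * x - C γ) :: t₃,
        mul_ne_zero hα hμ', mul_ne_zero hβ hκ', C_mul_mem_locSpan hb _, ?_, ?_, ?_⟩
      · intro y hy
        rcases List.mem_cons.1 hy with rfl | hy
        · exact Submodule.sub_mem _ ha (C_mem_locSpan c γ⁻¹)
        rcases List.mem_cons.1 hy with rfl | hy
        · exact hpow x (hrest x (by simp))
        · exact ht₃ y hy
      · intro y hy
        rcases List.mem_cons.1 hy with rfl | hy
        · have hdx : (C γ ^ 2 * x).totalDegree = x.totalDegree := by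
            rw [← map_pow, totalDegree_C_mul (pow_ne_zero 2 hγ0)]
          rw [totalDegree_sub_C (by rw [hdx]; exact hx0), hdx]
          exact hx0
        · have hmem : y.totalDegree ∈ t'.map totalDegree := by
            rw [← hdeg₃]
            exact List.mem_map.2 ⟨y, hy, rfl⟩
          obtain ⟨y₀, hy₀, hdy⟩ := List.mem_map.1 hmem
          rw [← hdy]
          exact htail y₀ (List.mem_cons_of_mem _ hy₀)
      · simp only [eprod_cons, Matrix.mul_assoc, map_mul]
        rw [eM_mul_eM_unit_mul_eM x a (C γ) (C γ⁻¹) hinv, conj₂ he,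
          conj₂ (eM_mul_dmat b (C κ') (C μ') (C μ'⁻¹) hinv'), dmat_mul_dmat_mul]

/-- COHN STANDARD FORM of a word over the `c`-local span: `wmat w = diag(α, β) · E(b) · eprod rest`,
`b ∈ locSpan`, `rest ⊆ locSpan`, interior letters `rest.tail` non-constant (or `w = []`). [this file] -/
theorem exists_std (w : List (MvPolynomial σ K × K × K))
    (hw : ∀ t ∈ w, t.1 ∈ locSpan K σ c ∧ t.2.1 ≠ 0 ∧ t.2.2 ≠ 0) :
    w = [] ∨ ∃ (α β : K) (b : MvPolynomial σ K) (rest : List (MvPolynomial σ K)), α ≠ 0 ∧ β ≠ 0 ∧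
      b ∈ locSpan K σ c ∧ (∀ z ∈ rest, z ∈ locSpan K σ c) ∧ (∀ z ∈ rest.tail, z.totalDegree ≠ 0) ∧
      wmat K w = dmat (C α) (C β) * eM b * eprod rest := by
  induction w using List.reverseRecOn with
  | nil => exact Or.inl rfl
  | append_singleton l t ih =>
    right
    obtain ⟨ha, hκ, hμ⟩ := hw t (by simp)
    have hl : ∀ s ∈ l, s.1 ∈ locSpan K σ c ∧ s.2.1 ≠ 0 ∧ s.2.2 ≠ 0 := fun s hs => hw s (by simp [hs])
    have hsplit : wmat K (l ++ [t]) = wmat K l * eM t.1 * dmat (C t.2.1) (C t.2.2) := by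
      rw [wmat_append, wmat_cons, wmat_nil, Matrix.mul_one, MvPolynomial.algebraMap_eq, ← Matrix.mul_assoc]
    rcases ih hl with rfl | ⟨α, β, b, rest, hα, hβ, hb, hrest, htail, hW⟩
    · -- a single letter `E(a) · diag(κ, μ) = diag(μ, κ) · E(μ⁻¹ κ a)`
      have hinv : C t.2.2 * C t.2.2⁻¹ = (1 : MvPolynomial σ K) := by
        rw [← C_mul, mul_inv_cancel₀ hμ, C_1]
      refine ⟨t.2.2, t.2.1, C (t.2.2⁻¹ * t.2.1) * t.1, [], hμ, hκ, C_mul_mem_locSpan ha _, by simp,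
        by simp, ?_⟩
      rw [hsplit, wmat_nil, Matrix.one_mul, eM_mul_dmat t.1 (C t.2.1) (C t.2.2) (C t.2.2⁻¹) hinv, map_mul,
        eprod_nil, Matrix.mul_one]
    · obtain ⟨α₁, β₁, b₁, rest₁, hα₁, hβ₁, hb₁, hrest₁, htail₁, hW₁⟩ :=
        std_mul_eM hα hβ hb hrest htail hW ha
      obtain ⟨α₂, β₂, b₂, rest₂, hα₂, hβ₂, hb₂, hrest₂, htail₂, hW₂⟩ :=
        std_mul_dmat hα₁ hβ₁ hb₁ hrest₁ htail₁ hW₁ hκ hμ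
      refine ⟨α₂, β₂, b₂, rest₂, hα₂, hβ₂, hb₂, hrest₂, htail₂, ?_⟩
      rw [hsplit]
      exact hW₂

end Std

/-! ## 3. The row walk and the main theorem (`σ = Fin m × Fin m`, `c < m`) -/

section Walk

variable {m c : ℕ}

/-- THE ROW WALK along `eprod t` (all letters `c`-local and non-constant) from a start matrix `N` whose row `0`
is in state `J` (`x ≠ 0`, `per_m ∤ topForm x`, `deg y ≤ deg x`) or `Z` (`(0, 1)`): row `0` of `N · eprod t` is
again in state `J` or `Z`. [this file] -/
theorem walk (hcm : c < m) (N : Matrix (Fin 2) (Fin 2) (MvPolynomial (Fin m × Fin m) K))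
    (t : List (MvPolynomial (Fin m × Fin m) K))
    (ht : ∀ z ∈ t, z ∈ locSpan K (Fin m × Fin m) c ∧ z.totalDegree ≠ 0)
    (hN : (N 0 0 ≠ 0 ∧ ¬ perPoly (Fin m) K ∣ topForm (N 0 0) ∧ (N 0 1).totalDegree ≤ (N 0 0).totalDegree) ∨
      (N 0 0 = 0 ∧ N 0 1 = 1)) :
    ((N * eprod t) 0 0 ≠ 0 ∧ ¬ perPoly (Fin m) K ∣ topForm ((N * eprod t) 0 0) ∧
        ((N * eprod t) 0 1).totalDegree ≤ ((N * eprod t) 0 0).totalDegree) ∨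
      ((N * eprod t) 0 0 = 0 ∧ (N * eprod t) 0 1 = 1) := by
  have hm : 0 < m := by omega
  induction t with
  | nil => simpa using hN
  | cons z t ih =>
    obtain ⟨hzL, hz1⟩ := ht z (by simp)
    have hz0 : z ≠ 0 := fun h => hz1 (by rw [h, totalDegree_zero])
    have hzP := not_perPoly_dvd_topForm hcm hzL hz0
    have h00 := (mul_eM_apply (N * eprod t) z).1
    have h01 := (mul_eM_apply (N * eprod t) z).2
    simp only [eprod_cons, ← Matrix.mul_assoc]
    rw [h00, h01]
    rcases ih (fun y hy => ht y (List.mem_cons_of_mem _ hy)) with ⟨hx, hxP, hyx⟩ | ⟨hx, hy⟩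
    · exact Or.inl (walk_step hm hx hxP hyx hz0 hz1 hzP)
    · refine Or.inl ⟨?_, ?_, ?_⟩
      · rw [hx, hy, zero_mul, zero_sub]
        exact neg_ne_zero.2 one_ne_zero
      · rw [hx, hy, zero_mul, zero_sub, show (-1 : MvPolynomial (Fin m × Fin m) K) = C (-1) by
          rw [map_neg, C_1], topForm_C]
        exact not_perPoly_dvd_C hm (neg_ne_zero.2 one_ne_zero)
      · rw [hx, totalDegree_zero]
        exact Nat.zero_le _

/-- UNIT RIGIDITY FOR WORDS. For `c < m`, every word `w` of letters `T(a, κ, μ)` with `a` in the `c`-local span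
and `κ, μ ≠ 0` satisfies: `per_m ∣ (wmat w)₀₁ ⇒ (wmat w)₀₁ = 0` (any field, any length; sharp at `c = m = 2`,
`DefinabilityGapZperTransfer.zperHits_two_fails`). [this file] -/
theorem wmat_zero_one_eq_zero (hcm : c < m) (w : List (MvPolynomial (Fin m × Fin m) K × K × K))
    (hw : ∀ t ∈ w, t.1 ∈ locSpan K (Fin m × Fin m) c ∧ t.2.1 ≠ 0 ∧ t.2.2 ≠ 0)
    (hdvd : perPoly (Fin m) K ∣ wmat K w 0 1) : wmat K w 0 1 = 0 := by
  have hm : 0 < m := by omega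
  rcases exists_std w hw with rfl | ⟨α, β, b, rest, hα, -, hb, hrest, htail, hW⟩
  · rw [wmat_nil]
    exact Matrix.one_apply_ne (by decide)
  rcases rest with _ | ⟨z, t⟩
  · -- `w` reduces to `diag(α, β) · E(b)`: the entry is the unit `C α`.
    exfalso
    rw [hW, Matrix.mul_assoc, dmat_mul_apply, eprod_nil, Matrix.mul_one, (eM_apply b).2, mul_one] at hdvd
    exact not_perPoly_dvd_C hm hα hdvd
  · -- `(wmat w)₀₁ = C α · (E(b) · eprod t)₀₀`: walk from `E(b)` along the interior letters `t`.
    have h01 : wmat K w 0 1 = C α * (eM b * eprod t) 0 0 := by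
      rw [hW, eprod_cons, ← Matrix.mul_assoc, (mul_eM_apply _ _).2, Matrix.mul_assoc, dmat_mul_apply]
    have hstart : (eM b 0 0 ≠ 0 ∧ ¬ perPoly (Fin m) K ∣ topForm (eM b 0 0) ∧
        (eM b 0 1).totalDegree ≤ (eM b 0 0).totalDegree) ∨ (eM b 0 0 = 0 ∧ eM b 0 1 = 1) := by
      rw [(eM_apply b).1, (eM_apply b).2]
      by_cases hb0 : b = 0
      · exact Or.inr ⟨hb0, rfl⟩
      · refine Or.inl ⟨hb0, not_perPoly_dvd_topForm hcm hb hb0, ?_⟩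
        rw [totalDegree_one]
        exact Nat.zero_le _
    rcases walk hcm (eM b) t (fun z hz => ⟨hrest z (List.mem_cons_of_mem _ hz), htail z hz⟩) hstart with
      ⟨-, hxP, -⟩ | ⟨hx, -⟩
    · exfalso
      rw [h01] at hdvd
      rcases (perPoly_prime hm).dvd_or_dvd hdvd with h | h
      · exact not_perPoly_dvd_C hm hα h
      · exact not_perPoly_dvd_of_topForm hxP h
    · rw [h01, hx, mul_zero]

end Walk

end

end Summit.ValiantsHypothesis.ValiantsHypothesis.Theorems.DefinabilityGapUnitRigidityWords
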